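import Literature.NumberTheory.LFunctions.Zhang2022.KnifeEdgeOffDiagForm

/-!
# Zhang (2022), rung F-S3 (Landau–Siegel programme, family B-len, class «μψ, top b > 1»):
# registry rows len-E7 (E-len-main(μψ, b > 1)) and len-E8 (E-len-offdiag(μψ, b > 1)) typed over
# the skeleton, and the POSITIVITY endgame proved at an arbitrary scale

Y. Zhang, *Discrete mean estimates and the Landau–Siegel zero*, arXiv:2211.02515v1 [Zhang2022LandauSiegel] —
an unrefereed manuscript under adjudication. **WHAT THIS IS NOT: not a claim about Theorems 1–2 of
arXiv:2211.02515, about Landau–Siegel zeros, or about Parity. The programme SEARCHES and TYPES; nothing here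
asserts any estimate: `MuPsiDict`, `MuPsiCloses`, `ScaleEventuallyPos` are bare `Prop`s with named slots
(registry rows len-E7 / len-E8 of `B-len/EDLIST.md` v1, parent row E-029 «E-multi-main(class, b)» of
`obj/EDREGISTRY.md`: status «derivation (in-house, unreviewed), NOT STARTED»), and every `theorem` is an
implication between them and the named nodes of `SkeletonPropositions` or elementary bookkeeping.**

**The class (B-len/PLAN.md v1 §1 (L-b) «μψ, b > 1»; B-len/REF.md §0 P-len-4; LEVERS L16).** The manuscript's
§2 «A heuristic argument» (p. 5; held TeX p0005:L102–111): "It is natural to consider the function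
`h(s,ψ) = Σ_{n<P′} f(log n/log P′) μψ(n) n^{−s}` for some `P′ < P`, where `f` is a polynomial with `f(1) = 0`.
It should be stressed, on assuming (A), that if `h(s,ψ)` is of the above form with `P′` slightly smaller than `P`
in the logarithmic scale, the sum in (2.16) can be evaluated. This is analogous to the results of Conrey, Iwaniec
and Soundararajan [5] and [6]. However, it seems that such a choice of `h(s,ψ)` is not good enough for our
purpose." — the ONE-SIDED Möbius-twisted mollifier (NO factor `χ`), which the manuscript rejects inside the wall
(`P′ < P`) and never evaluates. Family B-len's row len-E7 asks for its (A)-world main term CONTINUED PAST THE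
WALL (top `b = log N/log P ∈ (1, 5/4]`), row len-E8 for its off-diagonal main term (pairs `n ≡ m (mod p)`,
`n ≠ m ≤ P^b` — a Möbius-type twisted second moment over `ψ (mod p)`, `p ∼ P`, of length `p^b`, `b > 1`:
beyond the conductor of `ψ`; OPEN IN PRINT — nearest `Literature.NumberTheory.LFunctions.conreyIwaniecSoundararajan2019_theorem1`
(ALL moduli `q ≍ Q`, arbitrary `λ_h ≪ h^ε`, `ϑ < 1`), `…AsymptoticLargeSieve.conreyIwaniecSoundararajanALS_theorem24`
(structured coefficients, `X ≤ Q^{1−ε}`), `…buiPrattRoblesZaharescu2020_theorem11/12` (ONE prime modulus,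
`θ < 1/2 + 1/202`); none reaches `b > 1` for prime moduli in a window).

**What is typed, and why in this shape.** Neither the diagonal functional `𝔅_μ^{(b)}` of len-E7 (EDLIST: «expected:
the χ-free Möbius diagonal `Σ μ²(n)|g(z_n)|²/n`-type trivial-scale term + the (A)-world dipole corrections; LOSES
the Deuring–Heilbronn factor `𝔞` relative to chi-psi — LEVERS L16 HEURISTIC») nor its SCALE relative to `𝔞𝔓` has
been derived (status «not started»). A typer may not invent them. So, exactly as row E-001 carries its
off-diagonal form `O` as a PARAMETER (`KnifeEdge.EStarLen c' δ O`, p456081), this file carries THREE named slots: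

* `S` — the SCALE of the class's main term (`(D, χ) ↦ S D χ > 0`; for the chi-psi class `S = 𝔞`,
  `frakAScale`; for μψ the derivation decides: χ-free by the heuristic, so NOT `𝔞`);
* `M` — the DIAGONAL functional of the class at top `b` (len-E7's `𝔅_μ^{(b)}`; the EDLIST's expected LEADING
  term is typed separately as the explicit, evaluable `sqfreeDiagMass b g = (6/π²)∫₀^b ‖g‖²` — the density of
  squarefree integers times the `L²`-mass, i.e. the continuum form of `Σ_{n ≤ P^b} μ²(n)|g(z_n)|²/n / log P` — and
  is NOT hard-wired into the dictionary: it is a CANDIDATE for `M`, labelled so);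
* `X` — the OFF-DIAGONAL pair functional of the class (len-E8's `X_μ`, a `KnifeEdge.PairFunctional`, p442741),

and ONE dictionary statement `MuPsiDict c' b S M X` in the `ForAllLarge … AssumptionA → |mean − main·S·𝔓| ≤ ε·S·𝔓`
shape of `Skeleton.Eval823` / `KnifeEdge.EStarLen`: under (A), for every one-sided profile `g` of logarithmic
length `b` (`Repair.OneSidedProfile b g g'`: continuous on `[0,b]`, right derivative, `g(b) = 0` — the manuscript's
`f(1) = 0` at the top), the discrete mean (2.16) of the μψ profile polynomial of length `⌈P^b⌉` equals
`(M(g,g′) + Re X(g,g′,g,g′))·S·𝔓 + o(S·𝔓)`. Row len-E7 = the `(S, M)`-slots of `MuPsiDict`; row len-E8 = its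
`X`-slot, PRICED as `MuPsiCrossForm c' b C S M := ∃ X, OffDiagForm b X ∧ OneSidedBounded b C X ∧ MuPsiDict c' b S M X`
(the EDLIST shape, over ls-Blen-typer-1's D-len-1 `KnifeEdge.OffDiagForm`, p458017, with the WHOLE-PROFILE bound
`OneSidedBounded b C X : |Re X(g,g′,g,g′)| ≤ C·N_b(g)²`, `N_b(g)² = ∫₀^b(|g|² + |g′|²)`, in place of the two-piece
`OffDiagBounded`: the generic μψ mollifier `g(z) = 1 − z/b` has `g(1) ≠ 0`, so the split `u ⊕ v` of
`KnifeEdgeOverhangRankOne`, both pieces vanishing at the wall, does not cover the class).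

**PROVED here (the part that does not wait for any derivation).** (i) `eventually_not_assumptionA_of_negative_mainTerm_scale`:
the POSITIVITY ENDGAME of `KnifeEdgeEStarLen` for an ARBITRARY family of test values `F` and an ARBITRARY eventually
positive scale `S` — if under (A) some discrete mean has main term `m·S·𝔓 + o(S·𝔓)` with `m < 0`, then (given
Prop. 2.2 (i) and Lemma 2.3, which make every discrete mean `≥ 0`: (2.16) holds "for all functions `h(s,ψ)`")
(A) fails for all large `D`; no Cauchy–Schwarz, no §18 margin, and no use of `𝔞`. (ii) Hence
`theorem1_of_muPsiDict : MuPsiDict c' b S M X → ScaleEventuallyPos S → MuPsiCloses b M X → Prop22i → Lemma23 c' → Theorem1`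
(and `theorem2_of_muPsiDict`), where `MuPsiCloses b M X := ∃` one-sided `g` with `M(g,g′) + Re X(g,g′,g,g′) < 0` is
the class's decision statement (D-len-1 criterion (3) «overhangConst < 0 closes at s = 0», whole-piece form).
(iii) The ROBUST criterion of the class (the analogue of D-len-1's `RobustMargin`/`C*(d)` for whole profiles):
`RobustMuPsiMargin b C M := ∃` one-sided `g`, `M(g,g′) + C·N_b(g)² < 0`; `muPsiCloses_of_robustMargin` (it closes the
class against EVERY `C`-bounded `X`), `theorem1_of_robustMuPsiMargin`, and `not_robustMuPsiMargin_of_nonneg` /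
`not_robustMuPsiMargin_sqfreeDiagMass` (with a diagonal `≥ 0` — the registry's expectation, a sum of squares — no
robust margin exists for any `C ≥ 0`: the kernel form of ls-ref-1's price «μψ cannot yield a candidate», 17:11:45Z,
and of the manuscript's «not good enough»). (iv) Bookkeeping: `frakAScale_eventuallyPos` (`𝔞` is an admissible scale:
`frakALowerBound_holds`), `not_muPsiCloses_of_nonneg` (the (B1)/B-AH side), `sqfreeDiagMass_nonneg`,
`muPsiCloses_mono_X` (closing is monotone in `Re X(g,g)`), `oneSidedBounded_zero`/`OneSidedBounded.mono`,
`muPsi_class_inhabited` (the class is inhabited at every `b > 0` by Zhang's `ϰ_{b,k}` — crit-1's (J1) junk test),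
`muPsiPoly_zero_profile`, `discMean_zero_values` (sanity anchors for evaluators).

Deliberately NOT here: any formula for `𝔅_μ^{(b)}` beyond the labelled candidate; the derivation of the scale; a
construction of the class's off-diagonal `X_μ` (OPEN IN PRINT, len-E8 — only its priced existential); rows len-E5/E6 (Λ-overhang, ls-Blen-typer-1), len-E9a/b
(ν-overhang, after ls-theory); any claim that `MuPsiDict` or `MuPsiCloses` holds for the true `(S, M, X)`.
References: Zhang, arXiv:2211.02515v1, §2 (2.14)–(2.16), p. 5 «A heuristic argument», Lemma 2.3, Prop. 2.2 (i),
(2.31) (`𝔞`), §7 Prop 7.1 (7.2) [cite: Zhang2022LandauSiegel, §2 p. 5, (2.16), §7 Prop 7.1 (7.2)]; cell files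
B-len/EDLIST.md v1 (rows len-E7, len-E8, D-len-3), B-len/PLAN.md v1 §1, B-len/REF.md §0 P-len-4, theory/LEVERS.md
L16; tree `KnifeEdge.discMean`/`profPoly`/`weights_nonneg_of`/`discMean_nonneg`/`oneSidedProfile_kappaP` (p456081),
`KnifeEdge.OffDiagForm` (p458017), `Skeleton.theorem1_of_eventually_not_assumptionA`, `frakALowerBound_holds`,
`frakP_eventually_pos`.
-/

noncomputable section

open Complex Real Set
open _root_.MeasureTheory intervalIntegral

namespace Literature.NumberTheory.LFunctions.Zhang2022

namespace KnifeEdge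

open Repair Skeleton

/-! ### Part 1 — the μψ profile polynomial and the candidate leading diagonal (definitions) -/

/-- **Zhang's «natural» mollifier, continued to length `N`:** the one-sided Möbius-twisted profile polynomial
`Σ_{1≤n<N} μ(n)·ψ(n)·g(log n/log P)·n^{−s}` for the member `x = (p, ψ)` of the family `Ψ` (NO factor `χ`; compare
`KnifeEdge.profPoly`, whose coefficient is `ψχ(n)`). The manuscript takes `N = P′ < P` and a polynomial `f` with
`f(1) = 0`; row len-E7 takes `N = ⌈P^b⌉`, `b > 1`. [cite: Zhang2022LandauSiegel, §2 p. 5 «A heuristic argument»] -/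
def muPsiPoly {D : ℕ} (x : Chr D) (g : ℝ → ℂ) (N : ℕ) (s : ℂ) : ℂ :=
  ∑ n ∈ Finset.Ico 1 N,
    ((ArithmeticFunction.moebius n : ℤ) : ℂ) * x.ψ (n : ZMod x.p) * g (Real.log n / Real.log (bigP D)) *
      (n : ℂ) ^ (-s)

/-- **CANDIDATE leading diagonal of the class (EDLIST len-E7 «expected»; HEURISTIC, not derived):** the
squarefree-density `L²`-mass `(6/π²)·∫₀^b ‖g(z)‖² dz` — the continuum form of the χ-free Möbius diagonal
`(log P)⁻¹ Σ_{n ≤ P^b} μ²(n)|g(z_n)|²/n`. It is a candidate value for the `M`-slot of `MuPsiDict`, at a scale `S` the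
derivation must supply; it is NOT asserted to be the (A)-world main term. [cite: Zhang2022LandauSiegel, §2 p. 5] -/
def sqfreeDiagMass (b : ℝ) (g : ℝ → ℂ) : ℝ := 6 / Real.pi ^ 2 * ∫ z in (0:ℝ)..b, ‖g z‖ ^ 2

/-- The candidate diagonal is `≥ 0` for `b ≥ 0` (a sum of squares, as (2.16) predicts for every class diagonal).
[cite: Zhang2022LandauSiegel, §2 (2.16)] -/
theorem sqfreeDiagMass_nonneg {b : ℝ} (hb : 0 ≤ b) (g : ℝ → ℂ) : 0 ≤ sqfreeDiagMass b g := by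
  unfold sqfreeDiagMass
  refine mul_nonneg (by positivity) ?_
  exact intervalIntegral.integral_nonneg hb fun z _ => by positivity

/-! ### Part 2 — scales (the slot the class's derivation must fill; `𝔞` is the chi-psi instance) -/

/-- A SCALE for a class's main term: a real number `S(D, χ)` attached to each modulus and character (for the
chi-psi class `S = 𝔞 = frakA χ`, (2.31); for the μψ class the derivation decides — χ-free by LEVERS L16).
[cite: Zhang2022LandauSiegel, §2 (2.31)] -/
abbrev Scale : Type := (D : ℕ) → [NeZero D] → DirichletCharacter ℂ D → ℝ

/-- The scale is eventually positive under (A) (what the positivity endgame needs of it).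
[cite: Zhang2022LandauSiegel, §2 (2.31), Lemma 5.7] -/
def ScaleEventuallyPos (S : Scale) : Prop :=
  ForAllLarge fun D _ χ => AssumptionA D χ → 0 < S D χ

/-- The chi-psi class's scale of record, `𝔞 = (6/π²)L′(1,χ)²∏_{q∣D} q/(q+1)` (2.31).
[cite: Zhang2022LandauSiegel, §2 (2.31)] -/
def frakAScale : Scale := fun _ _ χ => frakA χ

/-- `𝔞` is an admissible scale: `𝔞 ≥ a₀ > 0` under (A) for all large `D` (`frakALowerBound_holds`, Lemma 5.7).
[cite: Zhang2022LandauSiegel, §5 Lemma 5.7, (2.31)] -/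
theorem frakAScale_eventuallyPos : ScaleEventuallyPos frakAScale := by
  obtain ⟨a₀, ha₀, h⟩ := frakALowerBound_holds
  exact h.mono fun D _ χ _ _ hD hA => lt_of_lt_of_le ha₀ (hD hA)

/-! ### Part 3 — rows len-E7 ⊕ len-E8: the (A)-world dictionary of the class and its decision statement
(bare `Prop`s with named slots; none asserted) -/

/-- **len-E7 ⊕ len-E8 — the ⟨A⟩-DICTIONARY of the class «μψ, top `b > 1`» with named slots** (scale `S`,
diagonal functional `M` = len-E7's `𝔅_μ^{(b)}`, off-diagonal pair functional `X` = len-E8's `X_μ`): `1 < b`, and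
under (A), for every one-sided profile `g` of logarithmic length `b` (`Repair.OneSidedProfile b g g'`), the
discrete mean (2.16) of the μψ profile polynomial of length `⌈P^b⌉` is `(M(g,g′) + Re X(g,g′,g,g′))·S(D,χ)·𝔓 + o(S·𝔓)`
— the shape of `KnifeEdge.EStarLen` (there: `S = 𝔞`, `M = Re 𝔅_{1+δ}`, `X = O`). Status: derivation NOT STARTED
(`S`, `M`); `X` OPEN IN PRINT (nearest: `conreyIwaniecSoundararajan2019_theorem1`, ALS Thm 2.4, BPRZ20 — module
docstring). Nothing asserted. [cite: Zhang2022LandauSiegel, §2 p. 5, (2.16), §7 Prop 7.1 (7.2)] -/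
def MuPsiDict (c' b : ℝ) (S : Scale) (M : (ℝ → ℂ) → (ℝ → ℂ) → ℝ) (X : PairFunctional) : Prop :=
  1 < b ∧ ∀ g g' : ℝ → ℂ, OneSidedProfile b g g' →
    ∀ ε : ℝ, 0 < ε → ForAllLarge fun D _ χ => AssumptionA D χ →
      |discMean c' χ (fun x s => muPsiPoly x g ⌈bigP D ^ b⌉₊ s)
          - (M g g' + (X g g' g g').re) * S D χ * frakP D| ≤ ε * S D χ * frakP D

/-- **The class CLOSES — decision statement** (whole-piece form of D-len-1 criterion (3) «overhangConst < 0 closes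
at `s = 0`»): some one-sided profile of length `b` has NEGATIVE completed main-term constant
`M(g,g′) + Re X(g,g′,g,g′) < 0`. Prediction B-AH (E-014): false for the true `(M, X)` — the completed class functional
is a sum of squares (`not_muPsiCloses_of_nonneg` is that bookkeeping). [cite: Zhang2022LandauSiegel, §2 (2.16)] -/
def MuPsiCloses (b : ℝ) (M : (ℝ → ℂ) → (ℝ → ℂ) → ℝ) (X : PairFunctional) : Prop :=
  ∃ g g' : ℝ → ℂ, OneSidedProfile b g g' ∧ M g g' + (X g g' g g').re < 0

/-! ### Part 4 — PROVED: the positivity endgame at an arbitrary scale, and the class's `Theorem1` implication -/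

section Endgame

/-- **THE POSITIVITY ENDGAME AT AN ARBITRARY SCALE.** If under (A) the discrete mean of SOME family of test values
`F(D, χ)` has main term `m·S·𝔓 + o(S·𝔓)` with `m < 0` and an eventually positive scale `S`, then — given
Prop. 2.2 (i) and Lemma 2.3, which make every discrete mean `≥ 0` ((2.16) "for all functions `h(s,ψ)`") — (A) fails
for every real primitive character to every large modulus. (`KnifeEdgeEStarLen.eventually_not_assumptionA_of_negative_mainTerm`
is the instance `S = 𝔞`, `F = profPoly`.) [cite: Zhang2022LandauSiegel, §2 (2.16), Lemma 2.3, Prop. 2.2 (i)] -/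
theorem eventually_not_assumptionA_of_negative_mainTerm_scale {c' m : ℝ} (hm : m < 0) {S : Scale}
    {F : (D : ℕ) → [NeZero D] → DirichletCharacter ℂ D → Chr D → ℂ → ℂ}
    (hS : ScaleEventuallyPos S)
    (hasymp : ∀ ε : ℝ, 0 < ε → ForAllLarge fun D _ χ => AssumptionA D χ →
      |discMean c' χ (F D χ) - m * S D χ * frakP D| ≤ ε * S D χ * frakP D)
    (h22 : Prop22i) (h23 : Lemma23 c') :
    ∃ D₀ : ℕ, ∀ (D : ℕ) [NeZero D] (χ : DirichletCharacter ℂ D),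
      D₀ ≤ D → χ.IsQuadratic → χ.IsPrimitive → ¬ AssumptionA D χ := by
  have hε : 0 < -m / 2 := by linarith
  obtain ⟨D₁, h₁⟩ := (((hasymp (-m / 2) hε).and h22).and h23).and hS
  obtain ⟨D₃, h₃⟩ := frakP_eventually_pos
  refine ⟨max D₁ (max D₃ 3), fun D _ χ hD hq hp hA => ?_⟩
  have hD₁ : D₁ ≤ D := le_trans (le_max_left _ _) hD
  have hD₃ : D₃ ≤ D := le_trans (le_trans (le_max_left _ _) (le_max_right _ _)) hD
  have hD3 : 3 ≤ D := le_trans (le_trans (le_max_right _ _) (le_max_right _ _)) hD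
  obtain ⟨⟨⟨hmean, h22'⟩, h23'⟩, hS'⟩ := h₁ D χ hD₁ hq hp
  have hmean' := hmean hA
  have hS0 : 0 < S D χ := hS' hA
  have hP0 : 0 < frakP D := h₃ D hD₃
  have hw := weights_nonneg_of hD3 h23' h22'
  have hpos := discMean_nonneg hw (F D χ)
  have hX : 0 < S D χ * frakP D := mul_pos hS0 hP0
  have hup := (abs_le.mp hmean').2
  nlinarith

variable {c' b : ℝ} {S : Scale} {M : (ℝ → ℂ) → (ℝ → ℂ) → ℝ} {X : PairFunctional}

/-- **B-len's POS endgame for the class «μψ, b > 1» as a kernel implication:** the dictionary + an admissible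
scale + the closing + Zhang's Part-1 zero model ⇒ Theorem 1 of the manuscript. The first three hypotheses are
rows len-E7/len-E8 (derivation not started / open in print; prediction B-AH: the closing fails); `Prop22i`,
`Lemma23 c'` are CLAIMS of the manuscript's §§3–4 — nothing is asserted. [cite: Zhang2022LandauSiegel, §2 p. 6, (2.16)] -/
theorem theorem1_of_muPsiDict (hE : MuPsiDict c' b S M X) (hS : ScaleEventuallyPos S)
    (hC : MuPsiCloses b M X) (h22 : Prop22i) (h23 : Lemma23 c') : Theorem1 := by
  obtain ⟨g, g', hg, hneg⟩ := hC
  exact Skeleton.theorem1_of_eventually_not_assumptionA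
    (eventually_not_assumptionA_of_negative_mainTerm_scale hneg hS
      (F := fun D _ _ x s => muPsiPoly x g ⌈bigP D ^ b⌉₊ s) (hE.2 g g' hg) h22 h23)

/-- … and Theorem 2. [cite: Zhang2022LandauSiegel, §1 Theorem 2] -/
theorem theorem2_of_muPsiDict (hE : MuPsiDict c' b S M X) (hS : ScaleEventuallyPos S)
    (hC : MuPsiCloses b M X) (h22 : Prop22i) (h23 : Lemma23 c') : Theorem2 :=
  Skeleton.theorem2_of_theorem1 (theorem1_of_muPsiDict hE hS hC h22 h23)

/-- **Obstruction bookkeeping (the B-AH side):** if the completed class functional `M + Re X(·,·)` is `≥ 0` on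
one-sided profiles of length `b`, the class never closes. [cite: Zhang2022LandauSiegel, §2 (2.16)] -/
theorem not_muPsiCloses_of_nonneg
    (h : ∀ g g' : ℝ → ℂ, OneSidedProfile b g g' → 0 ≤ M g g' + (X g g' g g').re) :
    ¬ MuPsiCloses b M X := by
  rintro ⟨g, g', hg, hneg⟩
  exact not_lt.2 (h g g' hg) hneg

/-- **Monotonicity of the closing in the off-diagonal slot:** if `X′` nets the overhang block down at least as
much as `X` (`Re X′(g,g) ≤ Re X(g,g)` on one-sided profiles), closing with `X` implies closing with `X′` — the
class closes, if at all, through an off-diagonal form that LOWERS the completed constant (the E-002 pricing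
direction). [cite: Zhang2022LandauSiegel, §2 (2.16)] -/
theorem muPsiCloses_mono_X {X' : PairFunctional}
    (hXX : ∀ g g' : ℝ → ℂ, OneSidedProfile b g g' → (X' g g' g g').re ≤ (X g g' g g').re)
    (h : MuPsiCloses b M X) : MuPsiCloses b M X' := by
  obtain ⟨g, g', hg, hneg⟩ := h
  exact ⟨g, g', hg, by have := hXX g g' hg; linarith⟩

/-- With the CANDIDATE diagonal `sqfreeDiagMass b` in the `M`-slot and an off-diagonal form with
`Re X(g,g) ≥ 0` on one-sided profiles, the class does not close (`b > 0`): the squarefree diagonal is a sum of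
squares. [cite: Zhang2022LandauSiegel, §2 (2.16)] -/
theorem not_muPsiCloses_sqfreeDiagMass (hb : 0 ≤ b)
    (hX : ∀ g g' : ℝ → ℂ, OneSidedProfile b g g' → 0 ≤ (X g g' g g').re) :
    ¬ MuPsiCloses b (fun g _ => sqfreeDiagMass b g) X :=
  not_muPsiCloses_of_nonneg fun g g' hg => add_nonneg (sqfreeDiagMass_nonneg hb g) (hX g g' hg)

end Endgame

/-! ### Part 5 — row len-E8 priced: `C`-bounded off-diagonal input on WHOLE one-sided profiles, the class's
`MuPsiCrossForm`, and the robust criterion (proved) -/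

section Robust

/-- `N_b(g)² = ∫₀^b (|g|² + |g′|²)`, the `H¹`-type size of a whole one-sided profile of length `b` (the analogue of
`KnifeEdge.inClassNorm² + overhangNorm²` of D-len-1 for a profile that need not vanish at the wall).
[cite: Zhang2022LandauSiegel, §7 Prop 7.1 (7.2)] -/
def oneSidedNormSq (b : ℝ) (g g' : ℝ → ℂ) : ℝ := ∫ t in (0:ℝ)..b, (‖g t‖ ^ 2 + ‖g' t‖ ^ 2)

/-- `N_b(g)² ≥ 0` for `b ≥ 0`. [cite: Zhang2022LandauSiegel, §7 Prop 7.1 (7.2)] -/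
theorem oneSidedNormSq_nonneg {b : ℝ} (hb : 0 ≤ b) (g g' : ℝ → ℂ) : 0 ≤ oneSidedNormSq b g g' :=
  intervalIntegral.integral_nonneg hb fun t _ => by positivity

/-- **`C`-bounded off-diagonal input on whole one-sided profiles of length `b`:** `|Re X(g,g′,g,g′)| ≤ C·N_b(g)²`
— the diagonal-slot half of D-len-1's `OffDiagBoundedOn` (p458017), stated for profiles that need NOT vanish at the
wall (the generic μψ mollifier `g(z) = 1 − z/b` has `g(1) = 1 − 1/b ≠ 0`, so the two-piece split `u ⊕ v` of
`KnifeEdgeOverhangRankOne` — both pieces vanish at `z = 1` — does not cover the class). Bare predicate, asserted for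
no `X`. [cite: Zhang2022LandauSiegel, §7 (7.2) p.44] -/
def OneSidedBounded (b C : ℝ) (X : PairFunctional) : Prop :=
  ∀ g g' : ℝ → ℂ, OneSidedProfile b g g' → |(X g g' g g').re| ≤ C * oneSidedNormSq b g g'

/-- `X = 0` is `C`-bounded for every `C ≥ 0` (`b ≥ 0`). [cite: Zhang2022LandauSiegel, §7 (7.2) p.44] -/
theorem oneSidedBounded_zero {b C : ℝ} (hb : 0 ≤ b) (hC : 0 ≤ C) : OneSidedBounded b C 0 := by
  intro g g' _
  simpa using mul_nonneg hC (oneSidedNormSq_nonneg hb g g')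

/-- `C`-boundedness is monotone in `C` (`b ≥ 0`). [cite: Zhang2022LandauSiegel, §7 (7.2) p.44] -/
theorem OneSidedBounded.mono {b C C' : ℝ} {X : PairFunctional} (hb : 0 ≤ b) (h : OneSidedBounded b C X)
    (hle : C ≤ C') : OneSidedBounded b C' X := fun g g' hg =>
  (h g g' hg).trans (mul_le_mul_of_nonneg_right hle (oneSidedNormSq_nonneg hb g g'))

/-- **len-E8 PRICED — `MuPsiCrossForm c' b C S M` (EDLIST shape «`∃ X, OffDiagForm b X ∧ OffDiagBounded b C X ∧
MuPsiOffDiagDict b X`», with the whole-profile bound `OneSidedBounded` in place of the two-piece `OffDiagBounded`):**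
the class's off-diagonal main term is SOME off-diagonal form (`KnifeEdge.OffDiagForm`, D-len-1: below-wall vanishing,
homogeneity) of size at most `C` on one-sided profiles of length `b`, for which the dictionary `MuPsiDict c' b S M ·`
holds. OPEN IN PRINT for every `b > 1` and every `C` (nearest printed ranges in the module docstring; ls-ref-1 price
XL-substantive, VERDICTS.md §9). The existential is the honest content of the row, not a construction.
[cite: Zhang2022LandauSiegel, §2 p. 5, §7 Prop 7.1 (7.2)] -/
def MuPsiCrossForm (c' b C : ℝ) (S : Scale) (M : (ℝ → ℂ) → (ℝ → ℂ) → ℝ) : Prop :=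
  ∃ X : PairFunctional, OffDiagForm b X ∧ OneSidedBounded b C X ∧ MuPsiDict c' b S M X

/-- **The ROBUST closing criterion of the class:** some one-sided profile of length `b` has
`M(g,g′) + C·N_b(g)² < 0` — then the class closes against EVERY `C`-bounded off-diagonal input
(`muPsiCloses_of_robustMargin`). With the registry's expectation `M ≥ 0` (a sum of squares) this never holds for
`C ≥ 0` (`not_robustMuPsiMargin_of_nonneg`): the μψ class cannot yield a candidate on price (ls-ref-1 17:11:45Z),
which is the kernel form of «such a choice of `h(s,ψ)` is not good enough». [cite: Zhang2022LandauSiegel, §2 p. 5, (2.16)] -/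
def RobustMuPsiMargin (b C : ℝ) (M : (ℝ → ℂ) → (ℝ → ℂ) → ℝ) : Prop :=
  ∃ g g' : ℝ → ℂ, OneSidedProfile b g g' ∧ M g g' + C * oneSidedNormSq b g g' < 0

variable {b C : ℝ} {M : (ℝ → ℂ) → (ℝ → ℂ) → ℝ} {X : PairFunctional}

/-- A robust margin closes the class against every `C`-bounded off-diagonal input.
[cite: Zhang2022LandauSiegel, §2 (2.16)] -/
theorem muPsiCloses_of_robustMargin (h : RobustMuPsiMargin b C M) (hX : OneSidedBounded b C X) :
    MuPsiCloses b M X := by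
  obtain ⟨g, g', hg, hlt⟩ := h
  refine ⟨g, g', hg, ?_⟩
  have hle : (X g g' g g').re ≤ C * oneSidedNormSq b g g' := (abs_le.mp (hX g g' hg)).2
  linarith

/-- … hence, with the dictionary at an admissible scale, Theorem 1 of the manuscript for every `C`-bounded `X`
(kernel implication; every analytic hypothesis is a named open row). [cite: Zhang2022LandauSiegel, §2 p. 6, (2.16)] -/
theorem theorem1_of_robustMuPsiMargin {c' : ℝ} {S : Scale} (h : RobustMuPsiMargin b C M)
    (hX : OneSidedBounded b C X) (hE : MuPsiDict c' b S M X) (hS : ScaleEventuallyPos S) (h22 : Prop22i)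
    (h23 : Lemma23 c') : Theorem1 :=
  theorem1_of_muPsiDict hE hS (muPsiCloses_of_robustMargin h hX) h22 h23

/-- No robust margin when the class diagonal is `≥ 0` on one-sided profiles and `C ≥ 0`, `b ≥ 0` (the registry's
expectation for `𝔅_μ^{(b)}`: a sum of squares). [cite: Zhang2022LandauSiegel, §2 (2.16)] -/
theorem not_robustMuPsiMargin_of_nonneg (hb : 0 ≤ b) (hC : 0 ≤ C)
    (hM : ∀ g g' : ℝ → ℂ, OneSidedProfile b g g' → 0 ≤ M g g') : ¬ RobustMuPsiMargin b C M := by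
  rintro ⟨g, g', hg, hlt⟩
  have := add_nonneg (hM g g' hg) (mul_nonneg hC (oneSidedNormSq_nonneg hb g g'))
  linarith

/-- In particular the CANDIDATE diagonal `sqfreeDiagMass b` admits no robust margin for `C ≥ 0`, `b ≥ 0`.
[cite: Zhang2022LandauSiegel, §2 p. 5] -/
theorem not_robustMuPsiMargin_sqfreeDiagMass (hb : 0 ≤ b) (hC : 0 ≤ C) :
    ¬ RobustMuPsiMargin b C (fun g _ => sqfreeDiagMass b g) :=
  not_robustMuPsiMargin_of_nonneg hb hC fun g _ _ => sqfreeDiagMass_nonneg hb g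

end Robust

/-! ### Part 6 — PROVED sanity anchors for the evaluators and the critics' junk tests -/

/-- **The class is inhabited at every length `b > 0`** (crit-1's (J1) test: a dictionary shape over an empty class
is vacuous): Zhang's own piece `ϰ_{b,k}` is a one-sided profile of length `b` (`KnifeEdge.oneSidedProfile_kappaP`,
p456081). [cite: Zhang2022LandauSiegel, §2 (2.23)–(2.25)] -/
theorem muPsi_class_inhabited {b : ℝ} (hb : 0 < b) (k : ℝ) :
    ∃ g g' : ℝ → ℂ, OneSidedProfile b g g' :=
  ⟨kappaP b k, kappaP' b k, oneSidedProfile_kappaP hb⟩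

/-- The μψ polynomial of the zero profile vanishes. [cite: Zhang2022LandauSiegel, §2 p. 5] -/
theorem muPsiPoly_zero_profile {D : ℕ} (x : Chr D) (N : ℕ) (s : ℂ) :
    muPsiPoly x (fun _ => 0) N s = 0 := by
  simp [muPsiPoly]

/-- The discrete mean of the zero family of values is `0` (so a dictionary with `M(0,0) + Re X(0,0,0,0) ≠ 0` at a
positive scale is refuted by the zero profile — a free consistency check on any proposed `(S, M, X)`).
[cite: Zhang2022LandauSiegel, §2 (2.16)] -/
theorem discMean_zero_values (c' : ℝ) {D : ℕ} (χ : DirichletCharacter ℂ D) :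
    discMean c' χ (fun _ _ => 0) = 0 := by
  simp [discMean]

end KnifeEdge

end Literature.NumberTheory.LFunctions.Zhang2022

end
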